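import Literature.MathematicalPhysics.QuantumLattice.HeisenbergRPUniformPositivity
import Literature.MathematicalPhysics.QuantumLattice.HeisenbergOrderNeelHolds
import Literature.MathematicalPhysics.QuantumLattice.HeisenbergOrderOnePointProofs
import Literature.MathematicalPhysics.QuantumLattice.HeisenbergOrderTranslationProofs
import Literature.MathematicalPhysics.QuantumLattice.HeisenbergOrderNeelShortRange
import Summits.HubbardSuperconductivity.HubbardLadder.Targets
import HarnessLib

/-!
# `S ≥ 1` sibling-model rung: an `L`-uniform strict Néel sign at the odd axis sites up to distance `εL`, and the `S = ½` conditional bridge `H₀ ⇒` the same (HubbardLadder, LEAN FILING REQUESTS #248 / #249)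

HONEST FRAMING: ladder R1–R4 with certified numbers; no claim on H/H₀.  SIBLING MODEL ONLY: the spin-`n/2`
Heisenberg antiferromagnet on the even torus `(ℤ/2kℤ)²` with `n ≥ 2` (`S ≥ 1`), `c_L(a,b) = heisRedCorr2 L n a b`
the reduced ground-state two-point function.  NOTHING here is about `S = ½` (`n = 1`, whose Néel order `H₀` is
open), nothing about the Hubbard model, and it is not an R2 row: a KERNEL COROLLARY of two printed theorems that are
already tree theorems, recorded for the evidence ledger of STRUCTURE.md §2.3 (what an `L`-GROWING range of uniform
sign statements looks like when long-range order IS available as an input).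

The two inputs:
* Kennedy–Lieb–Shastry (1988) — Néel long-range order in the ground state for `d = 2`, `S ≥ 1`
  (`kennedy_lieb_shastry_ground_holds`, `HasStaggeredEvenTorusLRO` of `⟨𝐒_x · 𝐒_y⟩`), unfolded to the one-point
  form `0 < liminf_k (2k+2)⁻² Σ_x (-1)^x ⟨𝐒_0 · 𝐒_x⟩` (`hasStaggeredEvenTorusLRO_iff_onePoint_holds`, translation
  invariance `groundStateSpinCorrTorus_add_right_holds`) and rewritten in reduced bookkeeping
  (`⟨𝐒_0·𝐒_x⟩ = 3 c_L(x)`, isotropy `groundStateSpinCorrTorus_one_eq_three_mul`) as an eventual lower bound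
  `C₁ (2k)² ≤ Σ_{a,b<2k} (-1)^{a+b} c_{2k}(a,b)` with some `C₁ > 0` (`kls_staggeredSum_eventually_ge`);
* Lees–Taggi (2021) Theorem 2 (i) as proved in §5, in the tree as
  `leesTaggi_uniformPositivity_oddAxis_eventually` (`Literature/…/HeisenbergRPUniformPositivity.lean`): such a
  lower bound forces, for every `0 ≤ φ < C₁`, an `ε > 0` with `-c_{2k}(m, 0) ≥ φ` for all odd `m ≤ εk`, eventually
  in `k`.

Composition (`neelSign_oddAxis_uniform_of_two_le`, and its `n = 2` instance `neelSign_oddAxis_spinOne_uniform`):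
for the `S ≥ 1` square-lattice antiferromagnet there is `C > 0` such that for every `0 ≤ φ < C` some `ε > 0` has
`φ ≤ -c_{2k}(m,0)` for all odd `m ≤ εk` and all large `k`; in particular (`heisRedCorr2_oddAxis_uniform_neg_of_two_le`)
a strict, `L`-uniform negative sign `c_{2k}(m,0) ≤ -φ < 0` at the odd sites `m ≤ εk` of the axis (a window growing
linearly with the side, not the whole axis).  The constants `C, ε` are existential (they come from a `liminf`); no
numerical input, zero kit, no named facts.  COUNT +0.  Labelled as what it is: Lees–Taggi 2021 Thm 2 (i) + KLS 1988
(Lees–Taggi print the `d ≥ 3` thermal instance as their Thm 5; the `d = 2`, `S ≥ 1` ground-state instance is the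
same routine combination) — not literature-new, not new mathematics.

The glue is stated once for EVERY spin `n/2` under the bare long-range-order hypothesis
`HasStaggeredEvenTorusLRO (fun L x y => groundStateSpinCorrTorus (d := 2) L n 1 x y)` (`staggeredSum_liminf_pos_of_lro`,
`staggeredSum_eventually_ge_of_lro`, `neelSign_oddAxis_uniform_of_lro`); the `n ≥ 2` theorems feed it KLS.  At `n = 1`
the hypothesis is exactly the cell's typed OPEN target `H₀ = NeelOrderSpinHalfSquare` (`Targets.lean`, `@[conjecture]`,
NOT claimed) at `J = 1`, which gives the CONDITIONAL BRIDGE `neelSign_oddAxis_spinHalf_uniform_of_neelOrder :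
NeelOrderSpinHalfSquare → (the same rung at n = 1)`: for `S = ½`, Néel order `H₀` implies an `L`-uniform strict Néel
sign at the odd axis sites `m ≤ εk`, eventually in `k` — the odd-axis, `L`-growing-window shape of the cell's sign
conjecture (S) is DOWNSTREAM of `H₀`.  Nothing is asserted about `H₀`; the bridge is a theorem with `H₀` as hypothesis;
no claim on H/H₀.
[cite: LeesTaggi2021, Theorem 2 (i), §5] [cite: KLS1988JSP, main Theorem (d = 2, S ≥ 1), eq. (3), and discussion after
eq. (4) (S = ½ open)] [cite: DLS1978, §1 eqs. (4), (4′)]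
-/

noncomputable section

namespace Summit.HubbardSuperconductivity.HubbardLadder

open Finset Filter Literature.MathematicalPhysics.QuantumLattice Literature.Probability.LatticeModels

/-! ### Bookkeeping: the one-point staggered sum in reduced coordinates -/

/-- `Σ_{x ∈ ℤ/Lℤ} g(x) = Σ_{a<L} g(a)`. [folklore] -/
private theorem sum_zmod_eq_sum_range (L : ℕ) [NeZero L] (g : ZMod L → ℝ) :
    ∑ x : ZMod L, g x = ∑ a ∈ range L, g (a : ZMod L) := by
  refine Finset.sum_nbij' (fun x : ZMod L => x.val) (fun a : ℕ => (a : ZMod L)) (fun x _ => ?_)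
    (fun a _ => mem_univ _) (fun x _ => ZMod.natCast_zmod_val x) (fun a ha => ?_) (fun x _ => ?_)
  · exact mem_range.2 (ZMod.val_lt x)
  · exact ZMod.val_cast_of_lt (mem_range.1 ha)
  · rw [ZMod.natCast_zmod_val]

/-- `Σ_{r ∈ (ℤ/Lℤ)²} F(r) = Σ_{a<L} Σ_{b<L} F(a, b)`. [folklore] -/
private theorem sum_torusSite_two_eq_sum_range (L : ℕ) [NeZero L] (F : TorusSite 2 L → ℝ) :
    ∑ r, F r = ∑ a ∈ range L, ∑ b ∈ range L, F ![(a : ZMod L), (b : ZMod L)] := by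
  rw [← Fintype.sum_equiv (piFinTwoEquiv fun _ => ZMod L).symm (fun ab => F ![ab.1, ab.2]) F
    (fun ab => rfl), Fintype.sum_prod_type, sum_zmod_eq_sum_range]
  exact sum_congr rfl fun a _ => sum_zmod_eq_sum_range L _

/-- **The one-point staggered sum of `⟨𝐒_0 · 𝐒_x⟩` in reduced bookkeeping**: on `(ℤ/Lℤ)²`, `L ≠ 0`,
`Σ_x (-1)^{x₁+x₂} ⟨𝐒_0 · 𝐒_x⟩_GS = 3 Σ_{a,b<L} (-1)^{a+b} c_L(a,b)` (isotropy `⟨𝐒_0·𝐒_x⟩ = 3 G⁰(0,x)` and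
`c_L(a,b) = G⁰(0,(a,b))`). [cite: KLS1988JSP, p. 1021 and eq. (3)] -/
theorem staggeredOnePointSum_eq_three_mul (L : ℕ) [NeZero L] (n : ℕ) :
    ∑ x : TorusSite 2 L, (-1 : ℝ) ^ (∑ i, (x i).val) * groundStateSpinCorrTorus L n 1 0 x =
      3 * ∑ a ∈ range L, ∑ b ∈ range L, (-1 : ℝ) ^ (a + b) * heisRedCorr2 L n a b := by
  rw [sum_torusSite_two_eq_sum_range, mul_sum]
  refine sum_congr rfl fun a ha => ?_
  rw [mul_sum]
  refine sum_congr rfl fun b hb => ?_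
  have hval : ∑ i, ((![(a : ZMod L), (b : ZMod L)] : TorusSite 2 L) i).val = a + b := by
    simp only [Fin.sum_univ_two, Matrix.cons_val_zero, Matrix.cons_val_one]
    rw [ZMod.val_cast_of_lt (mem_range.1 ha), ZMod.val_cast_of_lt (mem_range.1 hb)]
  rw [hval, groundStateSpinCorrTorus_one_eq_three_mul, heisRedCorr2]
  ring

/-! ### Kennedy–Lieb–Shastry long-range order in reduced bookkeeping -/

/-- **Néel order in reduced bookkeeping, `liminf` form** (every spin `n/2`): staggered long-range order of the
ground-state correlation `⟨𝐒_x · 𝐒_y⟩` along the even tori (`HasStaggeredEvenTorusLRO`, `J = 1`) is, unfolded by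
`hasStaggeredEvenTorusLRO_iff_onePoint_holds` (translation invariance `groundStateSpinCorrTorus_add_right_holds`)
and `staggeredOnePointSum_eq_three_mul`, the statement `0 < liminf_k 3 Σ_{a,b<2k+2} (-1)^{a+b} c_{2k+2}(a,b) / (2k+2)²`.
[cite: DLS1978, §1 eqs. (4), (4′)] [cite: KLS1988JSP, eq. (3)] -/
theorem staggeredSum_liminf_pos_of_lro (n : ℕ)
    (hLRO : HasStaggeredEvenTorusLRO (fun L x y => groundStateSpinCorrTorus (d := 2) L n 1 x y)) :
    0 < liminf (fun k : ℕ => 3 * (∑ a ∈ range (2 * k + 2), ∑ b ∈ range (2 * k + 2),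
        (-1 : ℝ) ^ (a + b) * heisRedCorr2 (2 * k + 2) n a b) / ((2 * k + 2 : ℕ) : ℝ) ^ 2) atTop := by
  have h := (hasStaggeredEvenTorusLRO_iff_onePoint_holds (d := 2)
    (fun L x y => groundStateSpinCorrTorus (d := 2) L n 1 x y)
    (fun L v x y => groundStateSpinCorrTorus_add_right_holds L n 1 v x y)).1 hLRO
  refine h.trans_eq (Filter.liminf_congr (Filter.Eventually.of_forall fun k => ?_))
  rw [staggeredOnePointSum_eq_three_mul]

/-- **KLS Néel order (`d = 2`, `S ≥ 1`) in reduced bookkeeping, `liminf` form**: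
`0 < liminf_k 3 Σ_{a,b<2k+2} (-1)^{a+b} c_{2k+2}(a,b) / (2k+2)²`.  This is
`kennedy_lieb_shastry_ground_holds` at `d = 2`, `n ≥ 2`, `J = 1`, fed to `staggeredSum_liminf_pos_of_lro`.
[cite: KLS1988JSP, main Theorem (d = 2, S ≥ 1), eq. (3)] [cite: DLS1978, §1 eqs. (4), (4′)] -/
theorem kls_staggeredSum_liminf_pos (n : ℕ) (hn : 2 ≤ n) :
    0 < liminf (fun k : ℕ => 3 * (∑ a ∈ range (2 * k + 2), ∑ b ∈ range (2 * k + 2),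
        (-1 : ℝ) ^ (a + b) * heisRedCorr2 (2 * k + 2) n a b) / ((2 * k + 2 : ℕ) : ℝ) ^ 2) atTop :=
  staggeredSum_liminf_pos_of_lro n (kennedy_lieb_shastry_ground_holds 2 n (Or.inr ⟨rfl, hn⟩) 1 one_pos)

/-- A priori lower bound `Σ_{a,b<L} (-1)^{a+b} c_L(a,b) ≥ -L² S²` (`|c_L| ≤ S²`). [folklore] -/
private theorem staggeredSum_ge (L n : ℕ) :
    -((L : ℝ) ^ 2 * ((n : ℝ) / 2) ^ 2) ≤
      ∑ a ∈ range L, ∑ b ∈ range L, (-1 : ℝ) ^ (a + b) * heisRedCorr2 L n a b := by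
  have hterm : ∀ a b : ℕ, -(((n : ℝ) / 2) ^ 2) ≤ (-1 : ℝ) ^ (a + b) * heisRedCorr2 L n a b := by
    intro a b
    have h1 := heisRedCorr2_abs_le L n a b
    have h2 : |(-1 : ℝ) ^ (a + b) * heisRedCorr2 L n a b| = |heisRedCorr2 L n a b| := by
      rw [abs_mul, abs_neg_one_pow, one_mul]
    have h3 := neg_abs_le ((-1 : ℝ) ^ (a + b) * heisRedCorr2 L n a b)
    rw [h2] at h3
    linarith
  calc -((L : ℝ) ^ 2 * ((n : ℝ) / 2) ^ 2)
      = ∑ a ∈ range L, ∑ b ∈ range L, -(((n : ℝ) / 2) ^ 2) := by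
        rw [sum_const, card_range, nsmul_eq_mul, sum_const, card_range, nsmul_eq_mul]; ring
    _ ≤ _ := sum_le_sum fun a _ => sum_le_sum fun b _ => hterm a b

/-- **Néel order as an eventual lower bound in the normalisation of Lees–Taggi** (every spin `n/2`): under
staggered long-range order of the ground state along the even tori there is `C₁ > 0` with
`C₁ (2k)² ≤ Σ_{a,b<2k} (-1)^{a+b} c_{2k}(a,b)` for all large `k` (take any `0 < C₁ < liminf/3`; the index shift
`2k+2 = 2(k+1)` is harmless along `atTop`). [cite: DLS1978, §1 eqs. (4), (4′)] [cite: KLS1988JSP, eq. (3)] -/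
theorem staggeredSum_eventually_ge_of_lro (n : ℕ)
    (hLRO : HasStaggeredEvenTorusLRO (fun L x y => groundStateSpinCorrTorus (d := 2) L n 1 x y)) :
    ∃ C₁ : ℝ, 0 < C₁ ∧ ∀ᶠ k : ℕ in atTop, C₁ * (2 * k : ℝ) ^ 2 ≤
      ∑ a ∈ range (2 * k), ∑ b ∈ range (2 * k), (-1 : ℝ) ^ (a + b) * heisRedCorr2 (2 * k) n a b := by
  set u : ℕ → ℝ := fun k => 3 * (∑ a ∈ range (2 * k + 2), ∑ b ∈ range (2 * k + 2),
        (-1 : ℝ) ^ (a + b) * heisRedCorr2 (2 * k + 2) n a b) / ((2 * k + 2 : ℕ) : ℝ) ^ 2 with hu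
  have hpos : 0 < liminf u atTop := staggeredSum_liminf_pos_of_lro n hLRO
  have hbdd : IsBoundedUnder (· ≥ ·) atTop u := by
    refine Filter.isBoundedUnder_of ⟨-(3 * ((n : ℝ) / 2) ^ 2), fun k => ?_⟩
    have hL : (0 : ℝ) < ((2 * k + 2 : ℕ) : ℝ) ^ 2 := by positivity
    show -(3 * ((n : ℝ) / 2) ^ 2) ≤ u k
    rw [hu, le_div_iff₀ hL]
    have hS := staggeredSum_ge (2 * k + 2) n
    push_cast at hS ⊢
    linarith
  set ℓ := liminf u atTop with hℓ
  have hev : ∀ᶠ k in atTop, ℓ / 2 < u k := eventually_lt_of_lt_liminf (by linarith) hbdd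
  refine ⟨ℓ / 6, by positivity, ?_⟩
  obtain ⟨N, hN⟩ := eventually_atTop.1 hev
  refine eventually_atTop.2 ⟨N + 1, fun k hk => ?_⟩
  obtain ⟨j, rfl⟩ : ∃ j, k = j + 1 := ⟨k - 1, by omega⟩
  have hj := hN j (by omega)
  have hL : (0 : ℝ) < ((2 * j + 2 : ℕ) : ℝ) ^ 2 := by positivity
  rw [hu, lt_div_iff₀ hL] at hj
  rw [show 2 * (j + 1) = 2 * j + 2 by ring]
  push_cast at hj ⊢
  linarith

/-- **KLS Néel order (`d = 2`, `S ≥ 1`) as an eventual lower bound in the normalisation of Lees–Taggi**: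
there is `C₁ > 0` with `C₁ (2k)² ≤ Σ_{a,b<2k} (-1)^{a+b} c_{2k}(a,b)` for all large `k`
(`staggeredSum_eventually_ge_of_lro` fed with `kennedy_lieb_shastry_ground_holds`).
[cite: KLS1988JSP, main Theorem (d = 2, S ≥ 1), eq. (3)] -/
theorem kls_staggeredSum_eventually_ge (n : ℕ) (hn : 2 ≤ n) :
    ∃ C₁ : ℝ, 0 < C₁ ∧ ∀ᶠ k : ℕ in atTop, C₁ * (2 * k : ℝ) ^ 2 ≤
      ∑ a ∈ range (2 * k), ∑ b ∈ range (2 * k), (-1 : ℝ) ^ (a + b) * heisRedCorr2 (2 * k) n a b :=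
  staggeredSum_eventually_ge_of_lro n (kennedy_lieb_shastry_ground_holds 2 n (Or.inr ⟨rfl, hn⟩) 1 one_pos)

/-! ### The rung -/

/-- **The rung under the bare long-range-order hypothesis** (every spin `n/2`; Lees–Taggi 2021 Thm 2 (i) as a map
LRO ⇒ uniform odd-axis sign): if the ground state of the spin-`n/2` antiferromagnet on `(ℤ/2kℤ)²` has staggered
long-range order along the even tori, then there is `C > 0` such that for every `0 ≤ φ < C` some `ε > 0` has
`φ ≤ -c_{2k}(m, 0)` for every odd `m ≤ εk`, for all large `k`.  A theorem with LRO as HYPOTHESIS; at `n = 1` the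
hypothesis is the open `H₀` (see `neelSign_oddAxis_spinHalf_uniform_of_neelOrder`); no claim on H/H₀.
[cite: LeesTaggi2021, Theorem 2 (i), §5] [cite: DLS1978, §1 eqs. (4), (4′)] -/
theorem neelSign_oddAxis_uniform_of_lro (n : ℕ)
    (hLRO : HasStaggeredEvenTorusLRO (fun L x y => groundStateSpinCorrTorus (d := 2) L n 1 x y)) :
    ∃ C : ℝ, 0 < C ∧ ∀ φ : ℝ, 0 ≤ φ → φ < C →
      ∃ ε : ℝ, 0 < ε ∧ ∀ᶠ k : ℕ in atTop, ∀ m : ℕ, Odd m → (m : ℝ) ≤ ε * k →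
        φ ≤ -heisRedCorr2 (2 * k) n m 0 := by
  obtain ⟨C₁, hC₁, hev⟩ := staggeredSum_eventually_ge_of_lro n hLRO
  exact ⟨C₁, hC₁, fun φ hφ hφC => leesTaggi_uniformPositivity_oddAxis_eventually n hφ hφC hev⟩

/-- **`S ≥ 1` sibling-model rung (kernel corollary of Lees–Taggi 2021 Thm 2 (i) + KLS 1988).**  For the
spin-`n/2` Heisenberg antiferromagnet on `(ℤ/2kℤ)²` with `n ≥ 2` there is `C > 0` such that for every
`0 ≤ φ < C` some `ε > 0` has, for all large `k` and every odd `m ≤ εk`, `φ ≤ -c_{2k}(m, 0)`: an `L`-uniform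
Néel sign at the odd sites of the axis in a window `m ≤ εk` growing linearly with the side.  Not about `S = ½`
(where the input, Néel order `H₀`, is open); no claim on H/H₀.
[cite: LeesTaggi2021, Theorem 2 (i), §5] [cite: KLS1988JSP, main Theorem (d = 2, S ≥ 1)] -/
theorem neelSign_oddAxis_uniform_of_two_le (n : ℕ) (hn : 2 ≤ n) :
    ∃ C : ℝ, 0 < C ∧ ∀ φ : ℝ, 0 ≤ φ → φ < C →
      ∃ ε : ℝ, 0 < ε ∧ ∀ᶠ k : ℕ in atTop, ∀ m : ℕ, Odd m → (m : ℝ) ≤ ε * k →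
        φ ≤ -heisRedCorr2 (2 * k) n m 0 :=
  neelSign_oddAxis_uniform_of_lro n (kennedy_lieb_shastry_ground_holds 2 n (Or.inr ⟨rfl, hn⟩) 1 one_pos)

/-- **The `S = 1` instance (`n = 2`)**: `∃ C > 0, ∀ 0 ≤ φ < C, ∃ ε > 0, ∀ᶠ k, ∀ m odd, m ≤ εk → φ ≤ -c_{2k}(m,0)`
for the spin-one square-lattice antiferromagnet.  Sibling-model rung; no claim on `S = ½` / H / H₀.
[cite: LeesTaggi2021, Theorem 2 (i), §5] [cite: KLS1988JSP, main Theorem (d = 2, S ≥ 1)] -/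
theorem neelSign_oddAxis_spinOne_uniform :
    ∃ C : ℝ, 0 < C ∧ ∀ φ : ℝ, 0 ≤ φ → φ < C →
      ∃ ε : ℝ, 0 < ε ∧ ∀ᶠ k : ℕ in atTop, ∀ m : ℕ, Odd m → (m : ℝ) ≤ ε * k →
        φ ≤ -heisRedCorr2 (2 * k) 2 m 0 :=
  neelSign_oddAxis_uniform_of_two_le 2 le_rfl

/-- **Strict `L`-uniform negative sign on the odd axis up to distance `εk`** (`n ≥ 2`): there are `φ > 0` and
`ε > 0` with `c_{2k}(m, 0) ≤ -φ` for every odd `m ≤ εk`, for all large `k`.  Sibling-model rung; no claim on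
`S = ½` / H / H₀. [cite: LeesTaggi2021, Theorem 2 (i), §5] [cite: KLS1988JSP, main Theorem (d = 2, S ≥ 1)] -/
theorem heisRedCorr2_oddAxis_uniform_neg_of_two_le (n : ℕ) (hn : 2 ≤ n) :
    ∃ φ : ℝ, 0 < φ ∧ ∃ ε : ℝ, 0 < ε ∧ ∀ᶠ k : ℕ in atTop, ∀ m : ℕ, Odd m → (m : ℝ) ≤ ε * k →
      heisRedCorr2 (2 * k) n m 0 ≤ -φ := by
  obtain ⟨C, hC, h⟩ := neelSign_oddAxis_uniform_of_two_le n hn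
  obtain ⟨ε, hε, hev⟩ := h (C / 2) (by positivity) (by linarith)
  exact ⟨C / 2, by positivity, ε, hε, hev.mono fun k hk m hm hmk => by linarith [hk m hm hmk]⟩

/-- The same rung along the second axis, `c_{2k}(0, m)` (`c_L(a,b) = c_L(b,a)`).  Sibling-model rung; no claim on
`S = ½` / H / H₀. [cite: LeesTaggi2021, Theorem 2 (i), §5] [cite: KLS1988JSP, main Theorem (d = 2, S ≥ 1)] -/
theorem neelSign_oddAxis_uniform_of_two_le_snd (n : ℕ) (hn : 2 ≤ n) :
    ∃ C : ℝ, 0 < C ∧ ∀ φ : ℝ, 0 ≤ φ → φ < C →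
      ∃ ε : ℝ, 0 < ε ∧ ∀ᶠ k : ℕ in atTop, ∀ m : ℕ, Odd m → (m : ℝ) ≤ ε * k →
        φ ≤ -heisRedCorr2 (2 * k) n 0 m := by
  obtain ⟨C, hC, h⟩ := neelSign_oddAxis_uniform_of_two_le n hn
  refine ⟨C, hC, fun φ hφ hφC => ?_⟩
  obtain ⟨ε, hε, hev⟩ := h φ hφ hφC
  refine ⟨ε, hε, (hev.and (eventually_ge_atTop 1)).mono fun k hk m hm hmk => ?_⟩
  haveI : NeZero (2 * k) := ⟨by omega⟩
  rw [heisRedCorr2_swap]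
  exact hk.1 m hm hmk

/-! ### The `S = ½` conditional bridge: `H₀ ⇒` the rung -/

/-- **CONDITIONAL BRIDGE `H₀ ⇒` odd-axis rung at `S = ½`.**  IF the ground state of the spin-½ Heisenberg
antiferromagnet on the square lattice has Néel long-range order along the even tori — the cell's typed OPEN target
`NeelOrderSpinHalfSquare` (`Targets.lean`, `@[conjecture]`, NOT claimed; Kennedy–Lieb–Shastry: "we cannot conclude …
that there is Néel order when S = 1/2") — THEN there is `C > 0` such that for every `0 ≤ φ < C` some `ε > 0` has
`φ ≤ -c_{2k}(m, 0)` (`c = heisRedCorr2 · 1`) for every odd `m ≤ εk`, for all large `k`.  A theorem with `H₀` as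
hypothesis (`neelSign_oddAxis_uniform_of_lro` at `n = 1`, `J = 1`); it records that the odd-axis, `L`-growing-window
form of the sign conjecture (S) is downstream of `H₀`.  No claim on H/H₀; +0.
[cite: LeesTaggi2021, Theorem 2 (i), §5] [cite: KLS1988JSP, discussion after eq. (4) (S = ½ open)] -/
theorem neelSign_oddAxis_spinHalf_uniform_of_neelOrder (hH₀ : NeelOrderSpinHalfSquare) :
    ∃ C : ℝ, 0 < C ∧ ∀ φ : ℝ, 0 ≤ φ → φ < C →
      ∃ ε : ℝ, 0 < ε ∧ ∀ᶠ k : ℕ in atTop, ∀ m : ℕ, Odd m → (m : ℝ) ≤ ε * k →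
        φ ≤ -heisRedCorr2 (2 * k) 1 m 0 :=
  neelSign_oddAxis_uniform_of_lro 1 (hH₀ 1 one_pos)

/-- **CONDITIONAL BRIDGE, strict-sign form**: `H₀ ⇒ ∃ φ > 0, ∃ ε > 0`, eventually in `k`, `c_{2k}(m, 0) ≤ -φ` for
every odd `m ≤ εk` (`S = ½`).  Hypothesis `NeelOrderSpinHalfSquare` is OPEN and not claimed; no claim on H/H₀; +0.
[cite: LeesTaggi2021, Theorem 2 (i), §5] [cite: KLS1988JSP, discussion after eq. (4) (S = ½ open)] -/
theorem heisRedCorr2_oddAxis_spinHalf_uniform_neg_of_neelOrder (hH₀ : NeelOrderSpinHalfSquare) :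
    ∃ φ : ℝ, 0 < φ ∧ ∃ ε : ℝ, 0 < ε ∧ ∀ᶠ k : ℕ in atTop, ∀ m : ℕ, Odd m → (m : ℝ) ≤ ε * k →
      heisRedCorr2 (2 * k) 1 m 0 ≤ -φ := by
  obtain ⟨C, hC, h⟩ := neelSign_oddAxis_spinHalf_uniform_of_neelOrder hH₀
  obtain ⟨ε, hε, hev⟩ := h (C / 2) (by positivity) (by linarith)
  exact ⟨C / 2, by positivity, ε, hε, hev.mono fun k hk m hm hmk => by linarith [hk m hm hmk]⟩

end Summit.HubbardSuperconductivity.HubbardLadder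

end
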